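import Mathlib
import Summits.Schanuel.Schanuel.Statement
import Literature.NumberTheory.Transcendental.RoyCriterion
import Literature.NumberTheory.Transcendental.RoyCriterionProofs
import HarnessLib

/-!
# Universal auxiliary polynomials: the hypothesis of Roy's Conjecture 2 does not depend on the point

`Summits/Schanuel/Schanuel/Theorems/SoloBlindUniversalAuxiliary.lean` (soloist `solo-Schanuel-blind`,
session 7).

Roy (Acta Arith. 97 (2001), Conjecture 2, Theorems 1–3) reformulated Schanuel's conjecture in rank `l`
as an arithmetic criterion: integer polynomials `P_N ∈ ℤ[X₀, X₁]` of partial degrees `≤ N^{t₀}`,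
`≤ N^{t₁}` and height `≤ e^N` whose `D`-derivatives (`D = ∂₀ + X₁∂₁`) up to order `N^{s₀}` are
`≤ e^{−N^u}` on the box `{(Σ mⱼyⱼ, Π αⱼ^{mⱼ}) : mⱼ ≤ N^{s₁}}` should force
`trdeg_ℚ ℚ(y, α) ≥ l`.  The tree already contains the Waldschmidt-type construction
`exists_royAuxPoly` (Roy's Theorem 3 with weaker constants): ONE polynomial `P_N` with
`|P_N(z, e^z)| ≤ e^{−2N^u}` on the whole disc `|z| ≤ 1 + cN^{s₁}`.

This file records, sorry-free, the quantifier swap that this construction affords and its reading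
for the summit:

* `royHypothesis_universal` — for admissible parameters and every `c ≥ 0` there is, for all large
  `N`, ONE non-zero `P_N` with Roy's profile such that the FULL hypothesis of Conjecture 2 (all
  derivatives `k ≤ N^{s₀}`, all translates `mⱼ ≤ N^{s₁}`) holds at `(y, e^y)` SIMULTANEOUSLY for
  every rank `l` and every `y ∈ ℂ^l` with `Σ‖yⱼ‖ ≤ c`.  The polynomials see nothing of `y`.
  (Specialising to one `y` with `c = Σ‖yⱼ‖` gives exactly the Literature fact
  `royHypothesis_exp'`, which is therefore not restated here.)
* `schanuelRank_iff_universalSequence` — consequently Schanuel's conjecture in rank `l` is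
  equivalent to the following "criterion": for every `c ≥ 0` and every sequence `(P_N)` of non-zero
  integer polynomials with Roy's profile and `sup_{|z| ≤ 1+cN^{s₁}} |P_N(z,e^z)| ≤ e^{−2N^u}`
  (eventually in `N`), every `ℚ`-linearly independent `y` in the ball `Σ‖yⱼ‖ ≤ c` has
  `trdeg_ℚ ℚ(y, e^y) ≥ l`.  The hypothesis of this criterion is a property of a sequence of
  exponential polynomials in ONE variable that does not mention `y`; together with the torsion
  reading of Roy's hypothesis (`SoloBlindRoyHypothesisTorsion.lean`: at `α ∉ μ_∞·e^y` the hypothesis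
  fails, at `α ∈ μ_∞·e^y` it holds) this pins down what the missing "arithmetic half" of Roy's
  programme must do: derive, from a `y`-independent sequence of small exponential polynomials and an
  algebraic subvariety `V ⊂ ℂ^{2l}` over `ℚ` of dimension `< l`, that `V` contains no point
  `(y, e^y)` with `y` linearly independent over `ℚ` — all information about the point has to come
  from `V`.

References: D. Roy, *An arithmetic criterion for the values of the exponential function*, Acta
Arith. 97 (2001) 183–194, Conjecture 2, Theorem 3 and §5; M. Waldschmidt, *Diophantine approximation
on linear algebraic groups* (2000), Conj. 15.36.
-/

noncomputable section

open Filter Complex MvPolynomial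

namespace Summit.Schanuel.Schanuel.Theorems

open Literature.NumberTheory.Transcendental

/-- **Universal auxiliary polynomials.** For admissible parameters `(s₀,s₁,t₀,t₁,u)` and `c ≥ 0`,
for all large `N` there is ONE non-zero `P_N ∈ ℤ[X₀,X₁]` with `deg_{X₀} ≤ N^{t₀}`,
`deg_{X₁} ≤ N^{t₁}`, height `≤ e^N`, such that `|(D^k P_N)(Σ mⱼyⱼ, Π (e^{yⱼ})^{mⱼ})| ≤ e^{−N^u}`
for ALL ranks `l`, ALL `y : Fin l → ℂ` with `Σ‖yⱼ‖ ≤ c`, all `k ≤ N^{s₀}` and all `mⱼ ≤ N^{s₁}`: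
the hypothesis of Roy's Conjecture 2 at `(y, e^y)` is witnessed uniformly in the point.
(Proof: `exists_royAuxPoly` gives `|P_N(z,e^z)| ≤ e^{−2N^u}` on `|z| ≤ 1 + cN^{s₁}`; Cauchy's
estimate on the unit circle around `z₀ = Σ mⱼyⱼ` and `k! e^{−2N^u} ≤ e^{−N^u}`.)
[this work; cf. Roy 2001, Thm. 3 and §5, 2°] -/
theorem royHypothesis_universal {s₀ s₁ t₀ t₁ u : ℝ} (hadm : RoyAdmissible s₀ s₁ t₀ t₁ u)
    {c : ℝ} (hc : 0 ≤ c) :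
    ∀ᶠ N : ℕ in atTop, ∃ P : MvPolynomial (Fin 2) ℤ, P ≠ 0 ∧
      (P.degreeOf 0 : ℝ) ≤ (N : ℝ) ^ t₀ ∧ (P.degreeOf 1 : ℝ) ≤ (N : ℝ) ^ t₁ ∧
      (mvPolyHeight P : ℝ) ≤ Real.exp N ∧
      ∀ (l : ℕ) (y : Fin l → ℂ), ∑ j, ‖y j‖ ≤ c →
        ∀ (k : ℕ) (m : Fin l → ℕ), (k : ℝ) ≤ (N : ℝ) ^ s₀ → (∀ j, (m j : ℝ) ≤ (N : ℝ) ^ s₁) →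
          ‖aeval ![∑ j, (m j : ℂ) * y j, ∏ j, cexp (y j) ^ m j] (royD^[k] P)‖ ≤
            Real.exp (-(N : ℝ) ^ u) := by
  filter_upwards [exists_royAuxPoly hadm hc, eventually_roy_params hadm hc] with N hN hN'
  obtain ⟨P, hP0, hd0, hd1, hH, hval⟩ := hN
  obtain ⟨-, -, -, hfact⟩ := hN'
  refine ⟨P, hP0, hd0, hd1, hH, fun l y hy k m hk hm => ?_⟩
  set z₀ : ℂ := ∑ j, (m j : ℂ) * y j with hz₀_def
  have hNs : (0 : ℝ) ≤ (N : ℝ) ^ s₁ := Real.rpow_nonneg (Nat.cast_nonneg N) s₁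
  have hz₀ : ‖z₀‖ ≤ c * (N : ℝ) ^ s₁ := by
    calc ‖z₀‖ ≤ ∑ j, ‖(m j : ℂ) * y j‖ := norm_sum_le _ _
      _ ≤ ∑ j, (N : ℝ) ^ s₁ * ‖y j‖ := by
          refine Finset.sum_le_sum fun j _ => ?_
          rw [norm_mul, Complex.norm_natCast]
          exact mul_le_mul_of_nonneg_right (hm j) (norm_nonneg _)
      _ = (N : ℝ) ^ s₁ * ∑ j, ‖y j‖ := by rw [Finset.mul_sum]
      _ ≤ (N : ℝ) ^ s₁ * c := mul_le_mul_of_nonneg_left hy hNs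
      _ = c * (N : ℝ) ^ s₁ := mul_comm _ _
  have hpt : (![∑ j, (m j : ℂ) * y j, ∏ j, cexp (y j) ^ m j] : Fin 2 → ℂ) = ![z₀, cexp z₀] := by
    have : ∏ j, cexp (y j) ^ m j = cexp z₀ := by
      rw [hz₀_def, Complex.exp_sum]
      refine Finset.prod_congr rfl fun j _ => ?_
      rw [← Complex.exp_nat_mul]
    rw [this]
  have hsphere : ∀ z ∈ Metric.sphere z₀ 1, ‖expEval P z‖ ≤ Real.exp (-(2 * (N : ℝ) ^ u)) := by
    intro z hz
    refine hval z ?_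
    have h1 : ‖z - z₀‖ = 1 := by simpa [dist_eq_norm] using hz
    calc ‖z‖ = ‖(z - z₀) + z₀‖ := by ring_nf
      _ ≤ ‖z - z₀‖ + ‖z₀‖ := norm_add_le _ _
      _ ≤ 1 + c * (N : ℝ) ^ s₁ := by rw [h1]; gcongr
  rw [hpt]
  calc ‖aeval ![z₀, cexp z₀] (royD^[k] P)‖ = ‖expEval (royD^[k] P) z₀‖ := rfl
    _ ≤ k.factorial * Real.exp (-(2 * (N : ℝ) ^ u)) :=
        norm_expEval_iterate_royD_le k P z₀ hsphere
    _ ≤ Real.exp (-(N : ℝ) ^ u) := hfact k hk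

/-- **Schanuel in rank `l` ⟺ the universal-sequence criterion.**  Fix admissible parameters.  Then
`SchanuelRank l` holds iff: for every `c ≥ 0` and EVERY sequence `(P_N)` of non-zero integer
polynomials with Roy's profile (`deg_{X₀} ≤ N^{t₀}`, `deg_{X₁} ≤ N^{t₁}`, height `≤ e^N`) and
`sup_{|z| ≤ 1+cN^{s₁}} |P_N(z, e^z)| ≤ e^{−2N^u}` for all large `N`, every `ℚ`-linearly independent
`y : Fin l → ℂ` with `Σ‖yⱼ‖ ≤ c` satisfies `l ≤ trdeg_ℚ ℚ(y, e^y)`.  The direction `→` is trivial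
(the conclusion does not use the sequence); the direction `←` is the existence of such sequences
(`exists_royAuxPoly`).  Reading: the only analytic input of Roy's programme is a `y`-free sequence
of small exponential polynomials in one variable; every bit of information about the point must be
supplied by the arithmetic half.  [this work] -/
theorem schanuelRank_iff_universalSequence {s₀ s₁ t₀ t₁ u : ℝ}
    (hadm : RoyAdmissible s₀ s₁ t₀ t₁ u) (l : ℕ) :
    SchanuelRank l ↔
      ∀ (c : ℝ), 0 ≤ c → ∀ (P : ℕ → MvPolynomial (Fin 2) ℤ),
        (∀ᶠ N : ℕ in atTop, P N ≠ 0 ∧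
          ((P N).degreeOf 0 : ℝ) ≤ (N : ℝ) ^ t₀ ∧ ((P N).degreeOf 1 : ℝ) ≤ (N : ℝ) ^ t₁ ∧
          (mvPolyHeight (P N) : ℝ) ≤ Real.exp N ∧
          ∀ z : ℂ, ‖z‖ ≤ 1 + c * (N : ℝ) ^ s₁ →
            ‖expEval (P N) z‖ ≤ Real.exp (-(2 * (N : ℝ) ^ u))) →
        ∀ (y : Fin l → ℂ), LinearIndependent ℚ y → ∑ j, ‖y j‖ ≤ c →
          (l : Cardinal) ≤ Algebra.trdeg ℚ
            ↥(IntermediateField.adjoin ℚ (Set.range y ∪ Set.range (cexp ∘ y))) := by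
  classical
  refine ⟨fun h c _ P _ y hy _ => h y hy, fun h y hy => ?_⟩
  set c : ℝ := ∑ j, ‖y j‖ with hc_def
  have hc : 0 ≤ c := Finset.sum_nonneg fun j _ => norm_nonneg _
  -- the property of the `N`-th universal polynomial
  let good : ℕ → MvPolynomial (Fin 2) ℤ → Prop := fun N Q =>
    Q ≠ 0 ∧ (Q.degreeOf 0 : ℝ) ≤ (N : ℝ) ^ t₀ ∧ (Q.degreeOf 1 : ℝ) ≤ (N : ℝ) ^ t₁ ∧
      (mvPolyHeight Q : ℝ) ≤ Real.exp N ∧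
      ∀ z : ℂ, ‖z‖ ≤ 1 + c * (N : ℝ) ^ s₁ → ‖expEval Q z‖ ≤ Real.exp (-(2 * (N : ℝ) ^ u))
  -- choose a sequence (zero where no witness exists)
  let P : ℕ → MvPolynomial (Fin 2) ℤ := fun N =>
    if hN : ∃ Q, good N Q then hN.choose else 0
  have hP : ∀ᶠ N : ℕ in atTop, good N (P N) := by
    filter_upwards [exists_royAuxPoly hadm hc] with N hN
    have hex : ∃ Q, good N Q := hN
    show good N (if hN : ∃ Q, good N Q then hN.choose else 0)
    rw [dif_pos hex]
    exact hex.choose_spec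
  exact h c hc P hP y hy le_rfl

/-- The same equivalence for the summit: Schanuel's conjecture holds iff the universal-sequence
criterion holds in every rank (for one, equivalently every, admissible parameter choice).
[this work] -/
theorem schanuel_iff_universalSequence {s₀ s₁ t₀ t₁ u : ℝ} (hadm : RoyAdmissible s₀ s₁ t₀ t₁ u) :
    _root_.Schanuel ↔ ∀ l : ℕ,
      ∀ (c : ℝ), 0 ≤ c → ∀ (P : ℕ → MvPolynomial (Fin 2) ℤ),
        (∀ᶠ N : ℕ in atTop, P N ≠ 0 ∧
          ((P N).degreeOf 0 : ℝ) ≤ (N : ℝ) ^ t₀ ∧ ((P N).degreeOf 1 : ℝ) ≤ (N : ℝ) ^ t₁ ∧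
          (mvPolyHeight (P N) : ℝ) ≤ Real.exp N ∧
          ∀ z : ℂ, ‖z‖ ≤ 1 + c * (N : ℝ) ^ s₁ →
            ‖expEval (P N) z‖ ≤ Real.exp (-(2 * (N : ℝ) ^ u))) →
        ∀ (y : Fin l → ℂ), LinearIndependent ℚ y → ∑ j, ‖y j‖ ≤ c →
          (l : Cardinal) ≤ Algebra.trdeg ℚ
            ↥(IntermediateField.adjoin ℚ (Set.range y ∪ Set.range (cexp ∘ y))) :=
  forall_congr' fun l => schanuelRank_iff_universalSequence hadm l

end Summit.Schanuel.Schanuel.Theorems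

end
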